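import Summits.AtomisticToContinuum.HydrodynamicLimit.Theorems.LambertianContactSwapLambertianEulerPairMeanSq
import HarnessLib

/-!
# The compensated collision jump of the one-body exponent (crux `LambertianEuler`, stmt-AtomisticToContinuum-11854, line `Sketch`, stub `stub_compensatedJumpExponentLambda`)

Registered stub `stub_compensatedJumpExponentLambda` of the lead skeleton
(`Cruxes/LambertianEuler/Lines/Sketch.lean`): the closed form of the noise-averaged jump, at a
Lambertian redraw of a pair `(i, j)`, of the sum over the particles of the **one-body exponent**
of the local Gibbs reference,
`g(x, v) = log b(x) - (3/2) log (2 π θ(x)) - ‖v - u(x)‖² / (2 θ(x))`.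

With `ω := G.sepVec xᵢ xⱼ ≠ 0`, `ω̂ := ω/‖ω‖`, `c := (vᵢ + vⱼ)/2`, `g := vᵢ - vⱼ` and
`δ := (‖g‖/3) ω̂ - g/2`, the redraw `lambertPair G i j z ξ`
(`Literature.MathematicalPhysics.KineticTheory.LambertianHardSphereFlow`) keeps all positions and all
particles `k ∉ {i, j}`, and gives `i`, `j` the velocities `c ± (‖g‖/2) n'`, `n' = lambertDir ω ξ`; then

`E_ξ[∑ₖ g(lambertPair … ξ k)] - ∑ₖ g(z k) = -⟪δ, (c - u(xᵢ))/θ(xᵢ) - (c - u(xⱼ))/θ(xⱼ)⟫`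

(`ξ` standard Gaussian in `ℝ³`).

## Proof

(1) Split the sums as `term i + term j + ∑_{k ≠ i, j}`; the last block is unchanged
(`lambertPair_apply_of_ne`) and the positions of `i, j` are unchanged (`lambertPair_apply_fst`), so only
the kinetic parts `-‖v' - u(x)‖²/(2θ(x))` of the `i`- and `j`-terms jump
(`integral_sum_lambertPair_sub_sum`, `integral_const_sub_div_sub`). (2) The two conditional second
moments are the landed pair moments `…PairMeanSq.stub_lambertPairMeanSq` (fed with the landed mean of
the cosine law `…LambertDirMean.stub_lambertDirMean`):
`E‖vᵢ' - uᵢ‖² = ‖c - uᵢ‖² + ‖g‖²/4 + (2/3)‖g‖⟪ω̂, c - uᵢ⟫`,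
`E‖vⱼ' - uⱼ‖² = ‖c - uⱼ‖² + ‖g‖²/4 - (2/3)‖g‖⟪ω̂, c - uⱼ⟫`. (3) Vector algebra: `vᵢ = c + g/2`,
`vⱼ = c - g/2`, `‖(c - u) ± g/2‖² = ‖c - u‖² + ‖g‖²/4 ± ⟪g, c - u⟫`, whence
`E‖vᵢ' - uᵢ‖² - ‖vᵢ - uᵢ‖² = 2⟪δ, c - uᵢ⟫`, `E‖vⱼ' - uⱼ‖² - ‖vⱼ - uⱼ‖² = -2⟪δ, c - uⱼ⟫`; divide by `2θ`
and collect (`jump_algebra`).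

References: H.-T. Yau, *Relative entropy and hydrodynamics of Ginzburg–Landau models*, Lett. Math.
Phys. 22 (1991) (the relative-entropy method along a local Gibbs reference); F. Comets, S. Popov,
G. M. Schütz, M. Vachkovskaia, *Billiards in a general domain with random reflections*, Arch. Ration.
Mech. Anal. 191 (2009) §2.1 (the Lambert/Knudsen cosine kernel). All statements here [folklore].
-/

noncomputable section

namespace Summit.AtomisticToContinuum.HydrodynamicLimit.Theorems.LambertianContactSwapLambertianEulerCompensatedJump

open scoped BigOperators Topology ENNReal InnerProductSpace
open MeasureTheory ProbabilityTheory Filter Set InformationTheory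
open Literature.MathematicalPhysics.KineticTheory
open Literature.Analysis.FluidPDE Literature.Analysis.FluidPDE.Alexander
open Summit.AtomisticToContinuum.HydrodynamicLimit.Theorems.LambertianContactSwapLambertianEulerLambertDirMean
open Summit.AtomisticToContinuum.HydrodynamicLimit.Theorems.LambertianContactSwapLambertianEulerPairMeanSq

/-! ### Bookkeeping: splitting off the unchanged particles -/

/-- A sum over `Fin N` is its `i`-term plus its `j`-term plus the rest (`i ≠ j`). [folklore] -/
theorem sum_eq_add_add_sum_erase_erase {M : Type*} [AddCommMonoid M] {N : ℕ} {i j : Fin N}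
    (hij : i ≠ j) (f : Fin N → M) :
    ∑ k, f k = f i + f j + ∑ k ∈ (Finset.univ.erase i).erase j, f k := by
  have hj : j ∈ Finset.univ.erase i := Finset.mem_erase.2 ⟨hij.symm, Finset.mem_univ j⟩
  rw [← Finset.add_sum_erase _ _ (Finset.mem_univ i), ← Finset.add_sum_erase _ _ hj, add_assoc]

/-- **The averaged jump of a one-body sum at a Lambertian redraw only involves the pair.** For
`i ≠ j` and any one-body observable `g` whose values on the two redrawn particles are integrable in the
noise, `E_ξ[∑ₖ g(lambertPair G i j z ξ k)] - ∑ₖ g(z k) = (E_ξ[g(·ᵢ')] - g(zᵢ)) + (E_ξ[g(·ⱼ')] - g(zⱼ))`: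
the particles `k ∉ {i, j}` are untouched (`lambertPair_apply_of_ne`). [folklore] -/
theorem integral_sum_lambertPair_sub_sum {N : ℕ} {G : Geometry (Fin 3) T3} {i j : Fin N}
    (hij : i ≠ j) (z : Config N (Fin 3) T3) (g : T3 × V3 → ℝ)
    (hi : Integrable (fun ξ => g (lambertPair G i j z ξ i)) (stdGaussian V3))
    (hj : Integrable (fun ξ => g (lambertPair G i j z ξ j)) (stdGaussian V3)) :
    ∫ ξ, (∑ k, g (lambertPair G i j z ξ k)) ∂(stdGaussian V3) - ∑ k, g (z k) =
      (∫ ξ, g (lambertPair G i j z ξ i) ∂(stdGaussian V3) - g (z i)) +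
        (∫ ξ, g (lambertPair G i j z ξ j) ∂(stdGaussian V3) - g (z j)) := by
  have hsplit : ∀ ξ : V3, ∑ k, g (lambertPair G i j z ξ k) =
      g (lambertPair G i j z ξ i) + g (lambertPair G i j z ξ j) +
        ∑ k ∈ (Finset.univ.erase i).erase j, g (z k) := fun ξ => by
    rw [sum_eq_add_add_sum_erase_erase hij]
    congr 1
    refine Finset.sum_congr rfl fun k hk => ?_
    simp only [Finset.mem_erase] at hk
    rw [lambertPair_apply_of_ne hk.2.1 hk.1]
  simp_rw [hsplit]
  rw [integral_add (hi.fun_add hj) (integrable_const _), integral_add hi hj, integral_const,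
    probReal_univ, one_smul, sum_eq_add_add_sum_erase_erase hij (fun k => g (z k))]
  ring

/-- `E[L - φ/s] - (L - x/s) = (x - E φ)/s` for a probability measure and an integrable `φ`. [folklore] -/
theorem integral_const_sub_div_sub (L s x : ℝ) {φ : V3 → ℝ} (hφ : Integrable φ (stdGaussian V3)) :
    ∫ ξ, (L - φ ξ / s) ∂(stdGaussian V3) - (L - x / s) =
      (x - ∫ ξ, φ ξ ∂(stdGaussian V3)) / s := by
  rw [integral_sub (integrable_const L) (hφ.div_const s), integral_div, integral_const,
    probReal_univ, one_smul]
  ring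

/-- The squared distance from `a` of the affine image `c + s • lambertDir ω ξ` of the Lambertian
direction is integrable in the Gaussian noise (it is a.e. an affine function of the bounded
direction, `norm_add_smul_lambertDir_sub_sq_ae`). [folklore] -/
theorem integrable_norm_add_smul_lambertDir_sub_sq (ω c a : V3) (s : ℝ) :
    Integrable (fun ξ : V3 => ‖c + s • lambertDir ω ξ - a‖ ^ 2) (stdGaussian V3) :=
  ((integrable_const _).add ((integrable_inner_lambertDir ω _).const_mul _)).congr
    (norm_add_smul_lambertDir_sub_sq_ae ω c a s).symm

/-! ### The vector algebra -/

/-- `‖vᵢ - u‖² = ‖c - u‖² + ‖g‖²/4 + ⟪g, c - u⟫` with `c = (vᵢ + vⱼ)/2`, `g = vᵢ - vⱼ`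
(`vᵢ = c + g/2`). [folklore] -/
theorem norm_left_sub_sq {E : Type*} [NormedAddCommGroup E] [InnerProductSpace ℝ E]
    (vi vj a : E) :
    ‖vi - a‖ ^ 2 = ‖(2 : ℝ)⁻¹ • (vi + vj) - a‖ ^ 2 + ‖vi - vj‖ ^ 2 / 4 +
      ⟪vi - vj, (2 : ℝ)⁻¹ • (vi + vj) - a⟫_ℝ := by
  have e : vi - a = ((2 : ℝ)⁻¹ • (vi + vj) - a) + (2 : ℝ)⁻¹ • (vi - vj) := by module
  rw [e, norm_add_sq_real, norm_smul, real_inner_smul_right, norm_inv, RCLike.norm_two,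
    real_inner_comm]
  ring

/-- `‖vⱼ - u‖² = ‖c - u‖² + ‖g‖²/4 - ⟪g, c - u⟫` with `c = (vᵢ + vⱼ)/2`, `g = vᵢ - vⱼ`
(`vⱼ = c - g/2`). [folklore] -/
theorem norm_right_sub_sq {E : Type*} [NormedAddCommGroup E] [InnerProductSpace ℝ E]
    (vi vj a : E) :
    ‖vj - a‖ ^ 2 = ‖(2 : ℝ)⁻¹ • (vi + vj) - a‖ ^ 2 + ‖vi - vj‖ ^ 2 / 4 -
      ⟪vi - vj, (2 : ℝ)⁻¹ • (vi + vj) - a⟫_ℝ := by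
  have e : vj - a = ((2 : ℝ)⁻¹ • (vi + vj) - a) + (-(2 : ℝ)⁻¹) • (vi - vj) := by module
  rw [e, norm_add_sq_real, norm_smul, real_inner_smul_right, norm_neg, norm_inv, RCLike.norm_two,
    real_inner_comm]
  ring

/-- **The vector algebra of the compensated jump.** With `c = (vᵢ + vⱼ)/2`, `g = vᵢ - vⱼ`, any vector
`ω` (the unit normal) and `δ := (‖g‖/3) ω - g/2`:
`(‖vᵢ - uᵢ‖² - Eᵢ)/(2θᵢ) + (‖vⱼ - uⱼ‖² - Eⱼ)/(2θⱼ) = -⟪δ, (c - uᵢ)/θᵢ - (c - uⱼ)/θⱼ⟫`, where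
`Eᵢ = ‖c - uᵢ‖² + ‖g‖²/4 + (2/3)‖g‖⟪ω, c - uᵢ⟫`, `Eⱼ = ‖c - uⱼ‖² + ‖g‖²/4 - (2/3)‖g‖⟪ω, c - uⱼ⟫` are
the two conditional second moments of the redraw. [folklore] -/
theorem jump_algebra {E : Type*} [NormedAddCommGroup E] [InnerProductSpace ℝ E]
    (vi vj ω ui uj : E) (θi θj : ℝ) :
    (‖vi - ui‖ ^ 2 - (‖(2 : ℝ)⁻¹ • (vi + vj) - ui‖ ^ 2 + ‖vi - vj‖ ^ 2 / 4 +
        2 / 3 * ‖vi - vj‖ * ⟪ω, (2 : ℝ)⁻¹ • (vi + vj) - ui⟫_ℝ)) / (2 * θi) +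
      (‖vj - uj‖ ^ 2 - (‖(2 : ℝ)⁻¹ • (vi + vj) - uj‖ ^ 2 + ‖vi - vj‖ ^ 2 / 4 -
        2 / 3 * ‖vi - vj‖ * ⟪ω, (2 : ℝ)⁻¹ • (vi + vj) - uj⟫_ℝ)) / (2 * θj) =
    -⟪(‖vi - vj‖ / 3) • ω - (2 : ℝ)⁻¹ • (vi - vj),
        θi⁻¹ • ((2 : ℝ)⁻¹ • (vi + vj) - ui) - θj⁻¹ • ((2 : ℝ)⁻¹ • (vi + vj) - uj)⟫_ℝ := by
  rw [norm_left_sub_sq vi vj ui, norm_right_sub_sq vi vj uj]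
  simp only [inner_sub_left, inner_sub_right, inner_add_right, real_inner_smul_left,
    real_inner_smul_right]
  ring

/-! ### The registered stub -/

/-- **Registered stub `stub_compensatedJumpExponentLambda`** (line `Sketch`, crux
stmt-AtomisticToContinuum-11854): **closed form of the noise-averaged jump of the one-body exponent at a
Lambertian redraw.** With `g(x, v) = log b(x) - (3/2) log(2πθ(x)) - ‖v - u(x)‖²/(2θ(x))`,
`c = (vᵢ + vⱼ)/2`, `gv = vᵢ - vⱼ`, `ω̂ = sepVec/‖sepVec‖`, `δ = (‖gv‖/3) ω̂ - gv/2` and `θ > 0` at `xᵢ, xⱼ`: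
`E_ξ[∑ₖ g(lambertPair G i j z ξ k)] - ∑ₖ g(z k) = -⟪δ, (c - u xᵢ)/θ xᵢ - (c - u xⱼ)/θ xⱼ⟫`
(split off the untouched particles, insert the pair moments `stub_lambertPairMeanSq` with the cosine-law
mean `stub_lambertDirMean`, vector algebra). [folklore] -/
theorem stub_compensatedJumpExponentLambda :
    ∀ (N : ℕ) (G : Geometry (Fin 3) T3) (i j : Fin N), i ≠ j →
      ∀ z : Config N (Fin 3) T3, G.sepVec (z i).1 (z j).1 ≠ 0 →
      ∀ (b θ : T3 → ℝ) (u : T3 → V3), 0 < θ (z i).1 → 0 < θ (z j).1 →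
        (let g := fun (y : T3 × V3) =>
           Real.log (b y.1) - 3 / 2 * Real.log (2 * Real.pi * θ y.1) - ‖y.2 - u y.1‖ ^ 2 / (2 * θ y.1)
         let c : V3 := (2 : ℝ)⁻¹ • ((z i).2 + (z j).2)
         let gv : V3 := (z i).2 - (z j).2
         let ωh : V3 := ‖G.sepVec (z i).1 (z j).1‖⁻¹ • G.sepVec (z i).1 (z j).1
         let δ : V3 := (‖gv‖ / 3) • ωh - (2 : ℝ)⁻¹ • gv
         ∫ ξ, (∑ k, g (lambertPair G i j z ξ k)) ∂(stdGaussian V3) - ∑ k, g (z k) =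
           -⟪δ, (θ (z i).1)⁻¹ • (c - u (z i).1) - (θ (z j).1)⁻¹ • (c - u (z j).1)⟫_ℝ) := by
  intro N G i j hij z hω b θ u _hθi _hθj g c gv ωh δ
  -- the two conditional second moments (landed pair moments, fed with the landed cosine-law mean)
  have hEi := (stub_lambertPairMeanSq stub_lambertDirMean N G i j hij z hω (u (z i).1)).1
  have hEj := (stub_lambertPairMeanSq stub_lambertDirMean N G i j hij z hω (u (z j).1)).2
  -- integrability of the two kinetic terms
  have hφi : Integrable (fun ξ : V3 => ‖(lambertPair G i j z ξ i).2 - u (z i).1‖ ^ 2)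
      (stdGaussian V3) := by
    refine (integrable_norm_add_smul_lambertDir_sub_sq (G.sepVec (z i).1 (z j).1)
      ((2 : ℝ)⁻¹ • ((z i).2 + (z j).2)) (u (z i).1) (‖(z i).2 - (z j).2‖ / 2)).congr
      (ae_of_all _ fun ξ => ?_)
    dsimp only
    rw [lambertPair_apply_left hij]
  have hφj : Integrable (fun ξ : V3 => ‖(lambertPair G i j z ξ j).2 - u (z j).1‖ ^ 2)
      (stdGaussian V3) := by
    refine (integrable_norm_add_smul_lambertDir_sub_sq (G.sepVec (z i).1 (z j).1)
      ((2 : ℝ)⁻¹ • ((z i).2 + (z j).2)) (u (z j).1) (-(‖(z i).2 - (z j).2‖ / 2))).congr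
      (ae_of_all _ fun ξ => ?_)
    dsimp only
    rw [lambertPair_apply_right, neg_smul, ← sub_eq_add_neg]
  -- the `i`- and `j`-jumps
  have hgi : ∀ ξ : V3, g (lambertPair G i j z ξ i) = (Real.log (b (z i).1) -
      3 / 2 * Real.log (2 * Real.pi * θ (z i).1)) -
        ‖(lambertPair G i j z ξ i).2 - u (z i).1‖ ^ 2 / (2 * θ (z i).1) := fun ξ => by
    simp only [g, lambertPair_apply_fst]
  have hgj : ∀ ξ : V3, g (lambertPair G i j z ξ j) = (Real.log (b (z j).1) -
      3 / 2 * Real.log (2 * Real.pi * θ (z j).1)) -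
        ‖(lambertPair G i j z ξ j).2 - u (z j).1‖ ^ 2 / (2 * θ (z j).1) := fun ξ => by
    simp only [g, lambertPair_apply_fst]
  have hint_i : Integrable (fun ξ => g (lambertPair G i j z ξ i)) (stdGaussian V3) := by
    simp_rw [hgi]
    exact (integrable_const _).sub' (hφi.div_const _)
  have hint_j : Integrable (fun ξ => g (lambertPair G i j z ξ j)) (stdGaussian V3) := by
    simp_rw [hgj]
    exact (integrable_const _).sub' (hφj.div_const _)
  have key_i : ∫ ξ, g (lambertPair G i j z ξ i) ∂(stdGaussian V3) - g (z i) =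
      (‖(z i).2 - u (z i).1‖ ^ 2 -
        (‖(2 : ℝ)⁻¹ • ((z i).2 + (z j).2) - u (z i).1‖ ^ 2 + ‖(z i).2 - (z j).2‖ ^ 2 / 4 +
          2 / 3 * ‖(z i).2 - (z j).2‖ *
            ⟪‖G.sepVec (z i).1 (z j).1‖⁻¹ • G.sepVec (z i).1 (z j).1,
              (2 : ℝ)⁻¹ • ((z i).2 + (z j).2) - u (z i).1⟫_ℝ)) / (2 * θ (z i).1) := by
    simp_rw [hgi]
    rw [← hEi]
    exact integral_const_sub_div_sub _ _ _ hφi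
  have key_j : ∫ ξ, g (lambertPair G i j z ξ j) ∂(stdGaussian V3) - g (z j) =
      (‖(z j).2 - u (z j).1‖ ^ 2 -
        (‖(2 : ℝ)⁻¹ • ((z i).2 + (z j).2) - u (z j).1‖ ^ 2 + ‖(z i).2 - (z j).2‖ ^ 2 / 4 -
          2 / 3 * ‖(z i).2 - (z j).2‖ *
            ⟪‖G.sepVec (z i).1 (z j).1‖⁻¹ • G.sepVec (z i).1 (z j).1,
              (2 : ℝ)⁻¹ • ((z i).2 + (z j).2) - u (z j).1⟫_ℝ)) / (2 * θ (z j).1) := by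
    simp_rw [hgj]
    rw [← hEj]
    exact integral_const_sub_div_sub _ _ _ hφj
  rw [integral_sum_lambertPair_sub_sum hij z g hint_i hint_j, key_i, key_j]
  exact jump_algebra (z i).2 (z j).2 _ (u (z i).1) (u (z j).1) (θ (z i).1) (θ (z j).1)

end Summit.AtomisticToContinuum.HydrodynamicLimit.Theorems.LambertianContactSwapLambertianEulerCompensatedJump

end
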